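import Mathlib
import HarnessLib
import Literature.MathematicalPhysics.QuantumLattice.GrassmannMonomialDeletion
import Literature.MathematicalPhysics.QuantumLattice.HubbardCovarianceCTNormalForm
import Summits.HubbardSuperconductivity.HubbardSuperconductivity.Theorems.KLProgrammeKLRegimeWickSecondOrder
import Summits.HubbardSuperconductivity.HubbardSuperconductivity.Theorems.KLProgrammeKLRegimeWickDressedLines

/-!
# Route `KLProgramme` — crux K3, ENGINE child (stmt-HubbardSuperconductivity-20236 `KLRegimeEngineV16` / gen-7-flow successor), stub
# `stub_engine_step_values`, conjunct (E2-v10)/(E2-F): the DRESSED Wick-ordered step — organisation (R1′), discrete, residual-free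

Cell gate-hubbard-kl, seat hubbard-kl-p1 (g10; (E2) Wick-toolkit lane).  The discrete Wick step `klw_wickAction_succ_cross`
(`𝒲_{n+1} = 𝒲_n − ½·dblFold((e^{Δ_×(g)} − 1)(e^{Δ_×(D)}(𝒲_n⁰𝒲_n¹))) + e^{Δ_D}R₃`) has all its vertices equal to copies of the INPUT; under (R1′)
(E2-SIGMA-DRESSING, evidence #28/#38 on 20236) the input's two-leg part `Q = presented (kernel 𝒱_n 2)` is resummed into the slice covariance BEFORE expanding,
so that no graph of the step carries a two-leg vertex of the input (KL STATUS 10:29Z (a): the discrete organisation is residual-free).  This file states that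
step exactly:

* §1 (generic, any `RCLike 𝕜`, any `Γ`) **`wickStep_cross`** — for covariances `g` (integrated) and `D` (kept) and an even input `V`,
  `e^{Δ_D}(effAction g V) = e^{Δ_{D+g}}V − ½·dblFold((e^{Δ_×(g)} − 1)(e^{Δ_×(D)}(W⁰W¹))) + e^{Δ_D}R₃(g,V)`, `W = e^{Δ_{D+g}}V`,
  `R₃ = effAction g V − e^{Δ_g}V + ½(e^{Δ_g}(V·V) − (e^{Δ_g}V)²)` — the covariance/input-generic form of `klw_wickAction_succ_cross`;
* §2 (model) **`klw_wickAction_succ_dressed`** — at frame `K`, step `n → n+1` (`g = g_{n+1} = normalCovariance s`, `D = D_{n+1}`): with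
  `κ(k,σ) = 2·kernel 𝒱_n 2 (ψ̂⁺_{kσ},ψ̂⁻_{kσ})`, `Q = presented (kernel 𝒱_n 2)`, `V′ = 𝒱_n − Q`, `m = (1 + sκ)⁻¹`, dressed slice `g̃ = normalCovariance (s/(1+sκ))`
  and `m`-pulled-back soft covariance `D^m(X,Y) = m(X)m(Y)D(X,Y)`:
  `𝒲_{n+1} = e^{Δ_D}(effAction g Q) + S_m( e^{Δ_{D^m+g̃}}V′ − ½·dblFold((e^{Δ_×(g̃)} − 1)(e^{Δ_×(D^m)}(W̃⁰W̃¹))) + e^{Δ_{D^m}}R₃(g̃, V′) )`, `W̃ = e^{Δ_{D^m+g̃}}V′`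
  — the first summand is the explicitly quadratic Gaussian action of `Q` alone; in the second, BOTH vertices are copies of `W̃` whose input `V′` has NO two-leg kernel
  (`kernel_two_sub_presented_kernel_two`), the lines are the DRESSED diagonal lines `g̃`, `D^m` (`contr_normalCovariance_eq_diagContr`), and the external legs carry
  `m` (`kernel_map_mulLeft`).  Composition of `klw_effectiveAction_succ`, `effAction_normalCovariance_add_twoLegPart` (p522645), `gaussConv_map_mulLeft` and §1.

Exact algebra over tree lemmas; the selection rules of `𝒱_n`'s two-leg kernels and the non-vanishing of the three partition functions are hypotheses (discharged by
`…WickConservation` / the norm bounds).  Nothing about sizes or superconductivity is asserted.  0 kit.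
-/

noncomputable section

namespace Summit.HubbardSuperconductivity.HubbardSuperconductivity.Theorems.KLRegimeWick

set_option linter.dupNamespace false -- summit = problem name (single-conjunct summit), D-0017

open Literature.MathematicalPhysics.QuantumLattice GrassmannAlgebra Finset Matrix
open Literature.Probability.LatticeModels
open Summit.HubbardSuperconductivity.HubbardSuperconductivity.Theorems.TwoPointAssembly
open Summit.HubbardSuperconductivity.HubbardSuperconductivity.Theorems.KLProgrammeLegKernels
open Summit.HubbardSuperconductivity.HubbardSuperconductivity.Theorems.KLRegimeSplit

/-! ## §1 Generic: the Wick-ordered one-step expansion at second order, for any covariance pair and any even input -/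

section Generic

variable {𝕜 : Type*} [RCLike 𝕜] {Γ : Type*} [Fintype Γ] [DecidableEq Γ]

/-- **`wickStep_cross`** — for covariances `g` (integrated) and `D` (kept) and an even `V`:
`e^{Δ_D}(effAction g V) = e^{Δ_{D+g}}V − ½·dblFold((e^{Δ_×(g)} − 1)(e^{Δ_×(D)}(W⁰·W¹))) + e^{Δ_D}R₃`, `W = e^{Δ_{D+g}}V`,
`R₃ = effAction g V − e^{Δ_g}V + ½(e^{Δ_g}(V·V) − (e^{Δ_g}V)·(e^{Δ_g}V))` (two copies of `W`, at least one `g`-line, no self-line; the generic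
form of `klw_wickAction_succ_cross`). -/
theorem wickStep_cross (g D : Matrix Γ Γ 𝕜) {V : GrassmannAlgebra 𝕜 Γ} (hVe : V ∈ evenOdd 𝕜 0) :
    gaussConv 𝕜 D (effAction 𝕜 g V) =
      gaussConv 𝕜 (D + g) V -
        (2 : 𝕜)⁻¹ • dblFold 𝕜 ((gaussConv 𝕜 (crossCov 𝕜 g) - 1)
          (gaussConv 𝕜 (crossCov 𝕜 D) (dblCopy 𝕜 0 (gaussConv 𝕜 (D + g) V) * dblCopy 𝕜 1 (gaussConv 𝕜 (D + g) V)))) +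
        gaussConv 𝕜 D (effAction 𝕜 g V - gaussConv 𝕜 g V +
          (2 : 𝕜)⁻¹ • (gaussConv 𝕜 g (V * V) - gaussConv 𝕜 g V * gaussConv 𝕜 g V)) := by
  have hWe : gaussConv 𝕜 (D + g) V ∈ evenOdd 𝕜 0 := gaussConv_mem_evenOdd 𝕜 _ hVe
  have h2 := gaussConv_secondCumulant_eq_wickStar_sub 𝕜 g D V
  rw [wickStar_add_sub_wickStar 𝕜 D g hWe] at h2
  rw [map_add, map_smul, h2, map_sub, gaussConv_add_apply]
  abel

end Generic

/-! ## §2 Model: the dressed Wick-ordered step at frame `K` -/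

section Model

variable (L M : ℕ) [NeZero L] [NeZero M] (β U μ : ℝ) (K : TrigPolyC4v)

omit [NeZero M] in
/-- The presented two-leg part is even. -/
theorem presented_two_mem_evenOdd_zero (φ : (Fin 2 → HubbardFieldIdx L M) → ℂ) : presented ℂ φ ∈ evenOdd ℂ 0 := by
  rw [presented]
  refine Submodule.sum_mem _ fun Y _ => Submodule.smul_mem _ _ ?_
  have h := genProd_mem_evenOdd ℂ Y
  rw [show ((2 : ℕ) : ZMod 2) = 0 by decide] at h
  exact h

omit [NeZero M] in
/-- The slice covariance of step `n+1` is the normal covariance of the slice symbol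
`s(k,σ) = (w^K_{Λ_{n+1}}(k) − w^K_{Λ_n}(k))·βL²·(iω+e_K)/nambuDen`. -/
theorem klw_sliceCov_succ_eq_normalCovariance (n : ℕ) :
    klSliceCov L M β μ K (n + 1) = normalCovariance L M (fun ks =>
      ((hubbardCutoffWeightCT L M β μ K (klScale klE0 (n + 1)) ks.1 : ℂ) - (hubbardCutoffWeightCT L M β μ K (klScale klE0 n) ks.1 : ℂ)) *
        (((β * (L : ℝ) ^ 2 : ℝ) : ℂ) * ((Complex.I * matsubaraFreq β M ks.1.1 + nambuXiCT L μ K ks.1.2) / nambuDenCT L M β μ 0 K ks.1))) := by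
  rw [klSliceCov, Nat.add_sub_cancel]
  exact hubbardCovSliceCT_zero_seed β μ K _ _

omit [NeZero M] in
/-- **`klw_wickAction_succ_dressed` — the DRESSED Wick-ordered step (organisation (R1′), discrete, residual-free).**  Frame `K`, step `n → n+1`,
with the slice symbol `s`, the input's two-leg symbol `κ = 2·kernel 𝒱_n 2 (ψ̂⁺,ψ̂⁻)`, `Q = presented (kernel 𝒱_n 2)`, `V′ = 𝒱_n − Q`, `m = (1 + sκ)⁻¹`,
`g̃ = normalCovariance (s/(1+sκ))`, `D = D_{n+1}`, `D^m(X,Y) = m(X)m(Y)D(X,Y)` (all passed as definitional hypotheses); assuming the step partition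
function at scale `n` is nonzero, the two-leg selection rules of `𝒱_n`, `1 + sκ ≠ 0`, and unit partition functions `Z_g(Q)`, `Z_{g̃}(V′)`:
`𝒲_{n+1} = e^{Δ_D}(effAction g Q) + S_m( e^{Δ_{D^m+g̃}}V′ − ½·dblFold((e^{Δ_×(g̃)} − 1)(e^{Δ_×(D^m)}(W̃⁰W̃¹))) + e^{Δ_{D^m}}R₃(g̃,V′) )`,
`W̃ = e^{Δ_{D^m+g̃}}V′`. -/
theorem klw_wickAction_succ_dressed (n : ℕ) (hZ : klStepPartitionFn L M β U μ K n ≠ 0)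
    (s κ : FreqMomentum L M × Fin 2 → ℂ) (m : HubbardFieldIdx L M → ℂ) (Q V' : HubbardGrassmann L M)
    (gt Dm : Matrix (HubbardFieldIdx L M) (HubbardFieldIdx L M) ℂ)
    (hs : s = fun ks =>
      ((hubbardCutoffWeightCT L M β μ K (klScale klE0 (n + 1)) ks.1 : ℂ) - (hubbardCutoffWeightCT L M β μ K (klScale klE0 n) ks.1 : ℂ)) *
        (((β * (L : ℝ) ^ 2 : ℝ) : ℂ) * ((Complex.I * matsubaraFreq β M ks.1.1 + nambuXiCT L μ K ks.1.2) / nambuDenCT L M β μ 0 K ks.1)))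
    (hκ : κ = fun ks => 2 * kernel ℂ (klEffectiveAction L M β U μ K klE0 n) 2 ![((ks, 0) : HubbardFieldIdx L M), (ks, 1)])
    (hm : m = fun X => (1 + s X.1 * κ X.1)⁻¹)
    (hQ : Q = presented ℂ (kernel ℂ (klEffectiveAction L M β U μ K klE0 n) 2))
    (hV' : V' = klEffectiveAction L M β U μ K klE0 n - Q)
    (hgt : gt = normalCovariance L M fun ks => s ks / (1 + s ks * κ ks))
    (hDm : Dm = Matrix.of fun X Y => m X * m Y * klSoftCov L M β μ K (n + 1) X Y)
    (hplus : ∀ (q : FreqMomentum L M) (σ : Fin 2) (Y : HubbardFieldIdx L M), Y ≠ ((q, σ), 1) →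
      kernel ℂ (klEffectiveAction L M β U μ K klE0 n) 2 ![((q, σ), 0), Y] = 0)
    (hminus : ∀ (q : FreqMomentum L M) (σ : Fin 2) (Y : HubbardFieldIdx L M), Y ≠ ((q, σ), 0) →
      kernel ℂ (klEffectiveAction L M β U μ K klE0 n) 2 ![((q, σ), 1), Y] = 0)
    (hden : ∀ ks : FreqMomentum L M × Fin 2, 1 + s ks * κ ks ≠ 0)
    (hZQ : IsUnit (effPartitionFn ℂ (klSliceCov L M β μ K (n + 1)) Q))
    (hZV : IsUnit (effPartitionFn ℂ gt V')) :
    klWickAction L M β U μ K (n + 1) =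
      gaussConv ℂ (klSoftCov L M β μ K (n + 1)) (effAction ℂ (klSliceCov L M β μ K (n + 1)) Q) +
        ExteriorAlgebra.map (LinearMap.mulLeft ℂ m)
          (gaussConv ℂ (Dm + gt) V' -
            (2 : ℂ)⁻¹ • dblFold ℂ ((gaussConv ℂ (crossCov ℂ gt) - 1)
              (gaussConv ℂ (crossCov ℂ Dm) (dblCopy ℂ 0 (gaussConv ℂ (Dm + gt) V') * dblCopy ℂ 1 (gaussConv ℂ (Dm + gt) V')))) +
            gaussConv ℂ Dm (effAction ℂ gt V' - gaussConv ℂ gt V' +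
              (2 : ℂ)⁻¹ • (gaussConv ℂ gt (V' * V') - gaussConv ℂ gt V' * gaussConv ℂ gt V'))) := by
  -- the input splits as `V′ + Q`, `V′` even without constant part
  set W : HubbardGrassmann L M := klEffectiveAction L M β U μ K klE0 n with hWdef
  have hsplit : W = V' + Q := by rw [hV', sub_add_cancel]
  have hV'0 : constPart ℂ V' = 0 := by
    rw [hV', hQ, constPart_sub_presented_two, hWdef, klEffectiveAction]
    exact constPart_hubbardEffectiveActionCT L M β U μ 0 K hZ
  have hV'e : V' ∈ evenOdd ℂ 0 := by
    rw [hV', hQ]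
    exact Submodule.sub_mem _ (klw_effectiveAction_mem_evenOdd_zero L M β U μ K n) (presented_two_mem_evenOdd_zero L M _)
  -- the slice is normal with symbol `s`
  have hg : klSliceCov L M β μ K (n + 1) = normalCovariance L M s := by
    rw [hs]; exact klw_sliceCov_succ_eq_normalCovariance L M β μ K n
  -- Step 1: `𝒲_{n+1} = e^{Δ_D}(effAction g 𝒱_n)`, and the two-leg resummation of `𝒱_n = V′ + Q`
  have hden' : ∀ ks : FreqMomentum L M × Fin 2, 1 + s ks * (2 * kernel ℂ W 2 ![((ks, 0) : HubbardFieldIdx L M), (ks, 1)]) ≠ 0 := by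
    intro ks; have h := hden ks; rwa [hκ] at h
  have hZQ' : IsUnit (effPartitionFn ℂ (normalCovariance L M s) (presented ℂ (kernel ℂ W 2))) := by
    rw [← hg, ← hQ]; exact hZQ
  have hZV'' : IsUnit (effPartitionFn ℂ (normalCovariance L M fun ks =>
      s ks / (1 + s ks * (2 * kernel ℂ W 2 ![((ks, 0) : HubbardFieldIdx L M), (ks, 1)]))) V') := by
    have h := hZV
    rw [hgt, hκ] at h
    exact h
  have hres := effAction_normalCovariance_add_twoLegPart (L := L) (M := M) s W V' hplus hminus hden' hV'0 hZQ' hZV''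
  -- rewrite in terms of the named objects
  have hm' : (fun X : HubbardFieldIdx L M => (1 + s X.1 * (2 * kernel ℂ W 2 ![((X.1, 0) : HubbardFieldIdx L M), (X.1, 1)]))⁻¹) = m := by
    rw [hm, hκ]
  have hgt' : (normalCovariance L M fun ks => s ks / (1 + s ks * (2 * kernel ℂ W 2 ![((ks, 0) : HubbardFieldIdx L M), (ks, 1)]))) = gt := by
    rw [hgt, hκ]
  rw [hm', hgt', ← hQ, ← hg] at hres
  -- Step 2: assemble
  rw [klWickAction, klw_effectiveAction_succ L M β U μ K n hZ, ← hWdef, hsplit, hres, map_add, gaussConv_map_mulLeft, ← hDm,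
    wickStep_cross gt Dm hV'e]

end Model

end Summit.HubbardSuperconductivity.HubbardSuperconductivity.Theorems.KLRegimeWick

end
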